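import Literature.MathematicalPhysics.QuantumFieldTheory.Balaban1983to89.Beta.BalabanStepJets
import Literature.MathematicalPhysics.QuantumFieldTheory.Balaban1983to89.Beta.ResolventComposition
import Literature.MathematicalPhysics.QuantumFieldTheory.Balaban1983to89.B4Reflection242

/-!
# `BalabanUV.Beta.GAN24.TaylorLamLeg` — binder row G-an2-4 / (CONV-C), S-slot road «S3-Taylor», generic leaf **L1** of
# `SKELETON-S3.md` v0.6 §12.7 (register tag «TAYLOR-L1*»): the MULTIPLIER-RESPONSE LEG `lamCoeffOf (KInv N) N` of the Lagrange rows
# Λ0∕Λt∕Λ carries EXACTLY the unit and the BLOCK-scale rate of leaf-18's (N1) for the fine minimiser column `wH`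

NOT IN PRINT; OUR PROOF ATTEMPT (unit b2b-balaban-gan24-formalise-leaf-13, gen 17; NEUTRAL name outside `StencilSlot*`; drafted in records
(INTENT CLAIMS l.4555, RESULT l.4571∕l.4582), FILED on the row owner's «go (as `GAN24/TaylorLamLeg`)», gan24-p1-g4 RULINGS-6, CLAIMS l.4599).  HONEST FRAMING (cell contract, verbatim): «discharging `BetaPertH` makes Bałaban's UV
stability UNCONDITIONAL — a real constructive-QFT result; it is NOT the continuum limit and NOT the Clay problem.»  HONEST DEPENDENCY
(verbatim): «continuum YM on T⁴ ⇐ BetaPertH ∧ nine spine estimates (0/9 proved); BetaPertH ⇐ (D1) ∧ (D4) ∧ CAP+tail; G-an2-4 gates asym,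
D1 and NE2/3/4.»  [folklore] finite-stencil smearing of a decaying kernel leg over an2's `BalabanStepJets.lamCoeffOf` ∕ `elCol` ∕ `box1` and
`OneStepResolventKernel.KInv`, with `ResolventComposition.GamΦ_eq_neg_wH` (ℋ♭ = −ℋᵀ) BY NAME; generic dimension `d`, generic blocking `N`;
0 cite, 0 `def … : Prop`, no estimate of (N1) itself, nothing about `e3Of`'s size; NOTHING of (hS, hSall) ∕ «E3Shape» is discharged.
NOT summit progress.

WHAT IS PROVED (0 sorry):
* §1 `abs_ediv_add_sub_ediv_le_one` ∕ `supNorm_quo_sub_quo_add_le_one`: moving a fine point inside the unit box `box1` moves its BLOCK label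
  `quo N` by at most `1` in sup norm; `supNorm_quo_sub_le_add_one`: hence `‖quo N u − y‖∞ ≤ ‖quo N (u+v) − y‖∞ + 1` for `v ∈ box1`
  (pv-side `B4Reflection242.supNorm_add_le` BY NAME).
* §2 **`abs_lamCoeffOf_le_block`** (the BLOCK-unit twin of an2's fine-unit `abs_lamCoeffOf_le`): for ANY packed kernel `A` whose
  multiplier–field leg at the coarse rows obeys `|A (N•y) x (inr μ) (inl α)| ≤ B·e^{−κ‖quo N x − y‖∞}` (`0 ≤ B`, `0 ≤ κ`),
  `|lamCoeffOf A N μ y κ′ u| ≤ (3^{d+1}·(d+1)·16(d+1)·B·e^{κ})·e^{−κ‖quo N u − y‖∞}`.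
* §3 `abs_KInv_inr_inl_le_of_wH`: (N1)'s literal shape `|wH κ l z| ≤ C·𝓊·e^{−κ₀‖quo N z‖∞}` transports to the (inr μ, inl α) leg of `KInv` at
  the coarse rows (`KInv_inr_inl_coarse` + `GamΦ_eq_neg_wH` + `quo_add_zsmul`); **`abs_lamCoeffOf_KInv_le_unit`** (leaf L1):
  `|lamCoeffOf (KInv N) N μ y κ′ u| ≤ (3^{d+1}·(d+1)·16(d+1)·(C·𝓊)·e^{κ₀})·e^{−κ₀‖quo N u − y‖∞}` — the unit `𝓊` (e.g. `(N^{d+2})⁻¹`) and the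
  block rate `κ₀` of (N1) pass through UNCHANGED; **`lamCoeffOf_KInv_levels`**: the level-uniform form — ONE `(κ₀, C)` for all levels
  `N = Lc^(j+1)` in (N1) gives ONE `(κ₀, C′)` for all levels here, with the SAME unit `((Lc^(j+1))^(d+2))⁻¹` (at `d = 3` this is leaf-16's
  `FineReadoutDecay.exists_wH_decay` shape `((Lc^(j+1))^5)⁻¹`, consumed BY NAME by whoever assembles row Λ — not imported here).
* §4 the BLOCK-ℓ¹ CURRENCY twins (RULINGS-5 adopted `|G l w| ≤ C·e^{−δ|quo N w − x′|₁}` for the row-W legs): `l1_quo_sub_quo_add_le`,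
  `l1_quo_sub_le_add`, **`abs_lamCoeffOf_le_block_l1`** (wobble cost `e^{(d+1)κ}`), **`abs_lamCoeffOf_KInv_le_unit_l1`**, and the bridge
  `exp_neg_l1_le_exp_neg_supNorm` (an ℓ¹-shaped input feeds the sup-currency lemmas at the same rate).
-/

noncomputable section

open Finset
open scoped BigOperators
open Literature.MathematicalPhysics.QuantumFieldTheory.LatticeForm (quo)
open Literature.MathematicalPhysics.QuantumFieldTheory.Balaban1983to89
open Literature.MathematicalPhysics.QuantumFieldTheory.Balaban1983to89.Beta
open B4ContourShift (supNorm abs_le_supNorm supNorm_nonneg exists_supNorm_eq)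
open B4Reflection242 (supNorm_add_le)
open BlochFibreUniqueness (quo_add_zsmul)
open KernelSpecInstance (wH)
open KKTFluctuationKernel (GamΦ)
open ResolventComposition (GamΦ_eq_neg_wH)
open OneStepResolventKernel (Fib KInv KInv_inr_inl_coarse)
open BalabanStepJets (lamCoeffOf elCol box1 mem_box1 abs_elCol_le)
open B12Sec2to5 (l1 l1_nonneg)
open ExpKernelCalculus (l1_sub_triangle)

namespace Summit.QuantumFields.BalabanUV.Beta.GAN24.TaylorLamLeg

variable {d : ℕ}

/-! ## §1 Block labels move by at most one over the unit box -/

/-- [folklore] For `N ≥ 1` and `|t| ≤ 1`: `|(a + t) / N − a / N| ≤ 1` (Euclidean division by a positive integer is monotone and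
`(a ± N) / N = a / N ± 1`). -/
theorem abs_ediv_add_sub_ediv_le_one {N : ℕ} (hN : 1 ≤ N) (a t : ℤ) (ht : t = -1 ∨ t = 0 ∨ t = 1) :
    |(a + t) / (N : ℤ) - a / (N : ℤ)| ≤ 1 := by
  have hN0 : (0 : ℤ) < N := by exact_mod_cast hN
  have hNne : (N : ℤ) ≠ 0 := hN0.ne'
  have hup : (a + t) / (N : ℤ) ≤ a / (N : ℤ) + 1 := by
    have h1 : a + t ≤ a + (N : ℤ) := by rcases ht with h | h | h <;> subst h <;> omega
    calc (a + t) / (N : ℤ) ≤ (a + (N : ℤ)) / (N : ℤ) := Int.ediv_le_ediv hN0 h1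
      _ = a / (N : ℤ) + 1 := by rw [show a + (N : ℤ) = a + 1 * (N : ℤ) by ring, Int.add_mul_ediv_right _ _ hNne]
  have hdown : a / (N : ℤ) - 1 ≤ (a + t) / (N : ℤ) := by
    have h1 : a - (N : ℤ) ≤ a + t := by rcases ht with h | h | h <;> subst h <;> omega
    calc a / (N : ℤ) - 1 = (a - (N : ℤ)) / (N : ℤ) := by
          rw [show a - (N : ℤ) = a + (-1) * (N : ℤ) by ring, Int.add_mul_ediv_right _ _ hNne]; ring
      _ ≤ (a + t) / (N : ℤ) := Int.ediv_le_ediv hN0 h1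
  rw [abs_le]; constructor <;> linarith

/-- [folklore] The block label of a fine point moves by at most `1` (sup norm) over the unit box:
`v ∈ box1 ⇒ ‖quo N u − quo N (u + v)‖∞ ≤ 1`. -/
theorem supNorm_quo_sub_quo_add_le_one {N : ℕ} (hN : 1 ≤ N) (u : Fin (d + 1) → ℤ) {v : Fin (d + 1) → ℤ}
    (hv : v ∈ box1 (d + 1)) : supNorm (quo N u - quo N (u + v)) ≤ 1 := by
  obtain ⟨i, hi⟩ := exists_supNorm_eq (quo N u - quo N (u + v))
  rw [hi]
  have h := abs_ediv_add_sub_ediv_le_one hN (u i) (v i) ((mem_box1.1 hv) i)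
  have h' : |quo N u i - quo N (u + v) i| ≤ 1 := by
    simp only [quo, Pi.add_apply]
    rw [abs_sub_comm]; exact h
  simp only [Pi.sub_apply]
  exact_mod_cast h'

/-- [folklore] Hence `‖quo N u − y‖∞ ≤ ‖quo N (u + v) − y‖∞ + 1` for `v ∈ box1`. -/
theorem supNorm_quo_sub_le_add_one {N : ℕ} (hN : 1 ≤ N) (u y : Fin (d + 1) → ℤ) {v : Fin (d + 1) → ℤ} (hv : v ∈ box1 (d + 1)) :
    supNorm (quo N u - y) ≤ supNorm (quo N (u + v) - y) + 1 := by
  have h := supNorm_add_le (quo N (u + v) - y) (quo N u - quo N (u + v))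
  rw [show quo N (u + v) - y + (quo N u - quo N (u + v)) = quo N u - y by abel] at h
  linarith [supNorm_quo_sub_quo_add_le_one hN u hv]

/-! ## §2 The block-unit smearing lemma for the multiplier-response coefficients -/

/-- [folklore] **BLOCK-UNIT DECAY OF THE MULTIPLIER-RESPONSE COEFFICIENTS** (twin of an2's `abs_lamCoeffOf_le`, which works in FINE
units): if the multiplier–field leg of a packed kernel `A` at the coarse rows obeys `|A (N•y) x (inr μ) (inl α)| ≤ B·e^{−κ‖quo N x − y‖∞}`,
then `|lamCoeffOf A N μ y κ′ u| ≤ (3^{d+1}·(d+1)·16(d+1)·B·e^{κ})·e^{−κ‖quo N u − y‖∞}` — the `3^{d+1}·(d+1)` terms of the column, an1's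
`|elCol| ≤ 16(d+1)`, and `e^{κ}` for the one-block wobble of `quo N (u+v)`. -/
theorem abs_lamCoeffOf_le_block {A : ExpKernelCalculus.MKer (d + 1) (Fib d)} {N : ℕ} (hN : 1 ≤ N) {B κ : ℝ} (hB : 0 ≤ B) (hκ : 0 ≤ κ)
    (hA : ∀ (y x : Fin (d + 1) → ℤ) (μ α : Fin (d + 1)),
      |A ((N : ℤ) • y) x (Sum.inr μ) (Sum.inl α)| ≤ B * Real.exp (-(κ * supNorm (quo N x - y))))
    (μ : Fin (d + 1)) (y : Fin (d + 1) → ℤ) (κ' : Fin (d + 1)) (u : Fin (d + 1) → ℤ) :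
    |lamCoeffOf A N μ y κ' u| ≤ ((3 : ℝ) ^ (d + 1) * ((d + 1 : ℕ) : ℝ) * (16 * ((d + 1 : ℕ) : ℝ)) * B * Real.exp κ) *
      Real.exp (-(κ * supNorm (quo N u - y))) := by
  unfold lamCoeffOf
  have hterm : ∀ v ∈ box1 (d + 1), ∀ α : Fin (d + 1),
      |A ((N : ℤ) • y) (u + v) (Sum.inr μ) (Sum.inl α) * elCol κ' u α (u + v)| ≤
        B * Real.exp κ * Real.exp (-(κ * supNorm (quo N u - y))) * (16 * ((d + 1 : ℕ) : ℝ)) := by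
    intro v hv α
    rw [abs_mul]
    refine mul_le_mul ?_ (abs_elCol_le κ' u α (u + v)) (abs_nonneg _) (by positivity)
    have h := hA y (u + v) μ α
    have htri := supNorm_quo_sub_le_add_one hN u y hv
    calc |A ((N : ℤ) • y) (u + v) (Sum.inr μ) (Sum.inl α)| ≤ B * Real.exp (-(κ * supNorm (quo N (u + v) - y))) := h
      _ ≤ B * (Real.exp κ * Real.exp (-(κ * supNorm (quo N u - y)))) := by
          refine mul_le_mul_of_nonneg_left ?_ hB
          rw [← Real.exp_add]
          exact Real.exp_le_exp.mpr (by nlinarith)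
      _ = B * Real.exp κ * Real.exp (-(κ * supNorm (quo N u - y))) := by ring
  have hcard : ((box1 (d + 1)).card : ℝ) = (3 : ℝ) ^ (d + 1) := by
    simp [box1, Fintype.card_piFinset]
  calc |∑ v ∈ box1 (d + 1), ∑ α : Fin (d + 1), A ((N : ℤ) • y) (u + v) (Sum.inr μ) (Sum.inl α) * elCol κ' u α (u + v)|
      ≤ ∑ v ∈ box1 (d + 1), ∑ α : Fin (d + 1), |A ((N : ℤ) • y) (u + v) (Sum.inr μ) (Sum.inl α) * elCol κ' u α (u + v)| :=
        (abs_sum_le_sum_abs _ _).trans (sum_le_sum fun v _ => abs_sum_le_sum_abs _ _)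
    _ ≤ ∑ v ∈ box1 (d + 1), ∑ _α : Fin (d + 1),
          B * Real.exp κ * Real.exp (-(κ * supNorm (quo N u - y))) * (16 * ((d + 1 : ℕ) : ℝ)) :=
        sum_le_sum fun v hv => sum_le_sum fun α _ => hterm v hv α
    _ = _ := by
        simp only [sum_const, card_univ, Fintype.card_fin, nsmul_eq_mul, hcard]
        push_cast
        ring

/-! ## §3 Leaf L1: the `lamCoeffOf (KInv N) N` leg in (N1)'s units -/

/-- [folklore] (N1)'s LITERAL shape for the fine minimiser column `wH` — `|wH κ l z| ≤ C·𝓊·e^{−κ₀‖quo N z‖∞}` — transports to the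
multiplier–field leg of the packed resolvent at the coarse rows: `|KInv (N•y) x (inr μ) (inl α)| ≤ C·𝓊·e^{−κ₀‖quo N x − y‖∞}`
(`KInv_inr_inl_coarse`: that leg IS `GamΦ μ y α x`; `GamΦ_eq_neg_wH`: `= −wH α μ (x − N•y)`; `quo_add_zsmul`). -/
theorem abs_KInv_inr_inl_le_of_wH {N : ℕ} [NeZero N] {C 𝓊 κ₀ : ℝ}
    (hH : ∀ (κ l : Fin (d + 1)) (z : Fin (d + 1) → ℤ), |wH (N := N) κ l z| ≤ C * 𝓊 * Real.exp (-(κ₀ * supNorm (quo N z))))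
    (y x : Fin (d + 1) → ℤ) (μ α : Fin (d + 1)) :
    |KInv (N := N) ((N : ℤ) • y) x (Sum.inr μ) (Sum.inl α)| ≤ C * 𝓊 * Real.exp (-(κ₀ * supNorm (quo N x - y))) := by
  rw [KInv_inr_inl_coarse, GamΦ_eq_neg_wH, abs_neg]
  have hq : quo N (x - (N : ℤ) • y) = quo N x - y := by
    rw [sub_eq_add_neg x, ← smul_neg, quo_add_zsmul, sub_eq_add_neg]
  have h := hH α μ (x - (N : ℤ) • y)
  rwa [hq] at h

/-- [folklore] **LEAF L1 — `abs_lamCoeffOf_KInv_le_unit`**: from (N1)'s literal shape for `wH` at blocking `N` (unit `𝓊`, block rate `κ₀`),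
`|lamCoeffOf (KInv N) N μ y κ′ u| ≤ (3^{d+1}·(d+1)·16(d+1)·(C·𝓊)·e^{κ₀})·e^{−κ₀‖quo N u − y‖∞}`: the multiplier-response leg of the
Lagrange rows carries EXACTLY (N1)'s unit and block-scale rate. -/
theorem abs_lamCoeffOf_KInv_le_unit {N : ℕ} [NeZero N] {C 𝓊 κ₀ : ℝ} (hC : 0 ≤ C) (h𝓊 : 0 ≤ 𝓊) (hκ : 0 ≤ κ₀)
    (hH : ∀ (κ l : Fin (d + 1)) (z : Fin (d + 1) → ℤ), |wH (N := N) κ l z| ≤ C * 𝓊 * Real.exp (-(κ₀ * supNorm (quo N z))))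
    (μ : Fin (d + 1)) (y : Fin (d + 1) → ℤ) (κ' : Fin (d + 1)) (u : Fin (d + 1) → ℤ) :
    |lamCoeffOf (KInv (N := N)) N μ y κ' u| ≤
      ((3 : ℝ) ^ (d + 1) * ((d + 1 : ℕ) : ℝ) * (16 * ((d + 1 : ℕ) : ℝ)) * (C * 𝓊) * Real.exp κ₀) *
        Real.exp (-(κ₀ * supNorm (quo N u - y))) :=
  abs_lamCoeffOf_le_block (Nat.one_le_iff_ne_zero.2 (NeZero.ne N)) (mul_nonneg hC h𝓊) hκ
    (fun y x μ α => abs_KInv_inr_inl_le_of_wH hH y x μ α) μ y κ' u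

/-- [folklore] **L1, LEVEL-UNIFORM FORM** (the shape the row-Λ assembly consumes): if (N1) holds with ONE `(κ₀, C)` for ALL levels
`N = Lc^(j+1)` and the unit `((Lc^(j+1))^(d+2))⁻¹` (at `d = 3`: leaf-16's `FineReadoutDecay.exists_wH_decay`, unit `((Lc^(j+1))^5)⁻¹`),
then the multiplier-response leg obeys the same kind of bound with ONE `(κ₀, C′)` for all levels and the SAME unit. -/
theorem lamCoeffOf_KInv_levels (Lc : ℕ) [NeZero Lc]
    (hN1 : ∃ κ₀ C : ℝ, 0 < κ₀ ∧ 0 ≤ C ∧ ∀ (j : ℕ) (κ l : Fin (d + 1)) (z : Fin (d + 1) → ℤ),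
      |wH (N := Lc ^ (j + 1)) κ l z| ≤ C * (((Lc ^ (j + 1) : ℕ) : ℝ) ^ (d + 2))⁻¹ * Real.exp (-(κ₀ * supNorm (quo (Lc ^ (j + 1)) z)))) :
    ∃ κ₀ C' : ℝ, 0 < κ₀ ∧ 0 ≤ C' ∧ ∀ (j : ℕ) (μ : Fin (d + 1)) (y : Fin (d + 1) → ℤ) (κ' : Fin (d + 1)) (u : Fin (d + 1) → ℤ),
      |lamCoeffOf (KInv (N := Lc ^ (j + 1))) (Lc ^ (j + 1)) μ y κ' u| ≤
        C' * (((Lc ^ (j + 1) : ℕ) : ℝ) ^ (d + 2))⁻¹ * Real.exp (-(κ₀ * supNorm (quo (Lc ^ (j + 1)) u - y))) := by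
  obtain ⟨κ₀, C, hκ₀, hC, h⟩ := hN1
  refine ⟨κ₀, (3 : ℝ) ^ (d + 1) * ((d + 1 : ℕ) : ℝ) * (16 * ((d + 1 : ℕ) : ℝ)) * C * Real.exp κ₀, hκ₀, by positivity, ?_⟩
  intro j μ y κ' u
  have hu : (0 : ℝ) ≤ (((Lc ^ (j + 1) : ℕ) : ℝ) ^ (d + 2))⁻¹ := by positivity
  have key := abs_lamCoeffOf_KInv_le_unit (N := Lc ^ (j + 1)) hC hu hκ₀.le (h j) μ y κ' u
  calc |lamCoeffOf (KInv (N := Lc ^ (j + 1))) (Lc ^ (j + 1)) μ y κ' u|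
      ≤ ((3 : ℝ) ^ (d + 1) * ((d + 1 : ℕ) : ℝ) * (16 * ((d + 1 : ℕ) : ℝ)) * (C * (((Lc ^ (j + 1) : ℕ) : ℝ) ^ (d + 2))⁻¹) * Real.exp κ₀) *
          Real.exp (-(κ₀ * supNorm (quo (Lc ^ (j + 1)) u - y))) := key
    _ = (3 : ℝ) ^ (d + 1) * ((d + 1 : ℕ) : ℝ) * (16 * ((d + 1 : ℕ) : ℝ)) * C * Real.exp κ₀ *
          (((Lc ^ (j + 1) : ℕ) : ℝ) ^ (d + 2))⁻¹ * Real.exp (-(κ₀ * supNorm (quo (Lc ^ (j + 1)) u - y))) := by ring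

/-! ## §4 The same in the BLOCK-ℓ¹ currency (the row-W leg currency adopted in RULINGS-5: `|G l w| ≤ C·e^{−δ|quo N w − x′|₁}`) -/

/-- [folklore] Over the unit box the block label moves by at most `d+1` in ℓ¹ norm: `v ∈ box1 ⇒ |quo N u − quo N (u + v)|₁ ≤ d + 1`. -/
theorem l1_quo_sub_quo_add_le {N : ℕ} (hN : 1 ≤ N) (u : Fin (d + 1) → ℤ) {v : Fin (d + 1) → ℤ} (hv : v ∈ box1 (d + 1)) :
    l1 (quo N u - quo N (u + v)) ≤ ((d + 1 : ℕ) : ℝ) := by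
  unfold l1
  calc ∑ i, |((quo N u - quo N (u + v)) i : ℝ)| ≤ ∑ _i : Fin (d + 1), (1 : ℝ) := Finset.sum_le_sum fun i _ => by
          have h := abs_ediv_add_sub_ediv_le_one hN (u i) (v i) ((mem_box1.1 hv) i)
          have h' : |quo N u i - quo N (u + v) i| ≤ 1 := by
            simp only [quo, Pi.add_apply]
            rw [abs_sub_comm]; exact h
          simp only [Pi.sub_apply, Int.cast_sub]
          exact_mod_cast h'
    _ = ((d + 1 : ℕ) : ℝ) := by simp

/-- [folklore] Hence `|quo N u − y|₁ ≤ |quo N (u + v) − y|₁ + (d + 1)` for `v ∈ box1`. -/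
theorem l1_quo_sub_le_add {N : ℕ} (hN : 1 ≤ N) (u y : Fin (d + 1) → ℤ) {v : Fin (d + 1) → ℤ} (hv : v ∈ box1 (d + 1)) :
    l1 (quo N u - y) ≤ l1 (quo N (u + v) - y) + ((d + 1 : ℕ) : ℝ) := by
  have h := l1_sub_triangle (quo N u) (quo N (u + v)) y
  linarith [l1_quo_sub_quo_add_le hN u hv]

/-- [folklore] **BLOCK-ℓ¹ TWIN of `abs_lamCoeffOf_le_block`**: hypothesis and conclusion with `e^{−κ|quo N · − y|₁}`; the wobble now costs
`e^{(d+1)κ}`. -/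
theorem abs_lamCoeffOf_le_block_l1 {A : ExpKernelCalculus.MKer (d + 1) (Fib d)} {N : ℕ} (hN : 1 ≤ N) {B κ : ℝ} (hB : 0 ≤ B) (hκ : 0 ≤ κ)
    (hA : ∀ (y x : Fin (d + 1) → ℤ) (μ α : Fin (d + 1)),
      |A ((N : ℤ) • y) x (Sum.inr μ) (Sum.inl α)| ≤ B * Real.exp (-(κ * l1 (quo N x - y))))
    (μ : Fin (d + 1)) (y : Fin (d + 1) → ℤ) (κ' : Fin (d + 1)) (u : Fin (d + 1) → ℤ) :
    |lamCoeffOf A N μ y κ' u| ≤ ((3 : ℝ) ^ (d + 1) * ((d + 1 : ℕ) : ℝ) * (16 * ((d + 1 : ℕ) : ℝ)) * B *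
      Real.exp (((d + 1 : ℕ) : ℝ) * κ)) * Real.exp (-(κ * l1 (quo N u - y))) := by
  unfold lamCoeffOf
  have hterm : ∀ v ∈ box1 (d + 1), ∀ α : Fin (d + 1),
      |A ((N : ℤ) • y) (u + v) (Sum.inr μ) (Sum.inl α) * elCol κ' u α (u + v)| ≤
        B * Real.exp (((d + 1 : ℕ) : ℝ) * κ) * Real.exp (-(κ * l1 (quo N u - y))) * (16 * ((d + 1 : ℕ) : ℝ)) := by
    intro v hv α
    rw [abs_mul]
    refine mul_le_mul ?_ (abs_elCol_le κ' u α (u + v)) (abs_nonneg _) (by positivity)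
    have h := hA y (u + v) μ α
    have htri := l1_quo_sub_le_add hN u y hv
    calc |A ((N : ℤ) • y) (u + v) (Sum.inr μ) (Sum.inl α)| ≤ B * Real.exp (-(κ * l1 (quo N (u + v) - y))) := h
      _ ≤ B * (Real.exp (((d + 1 : ℕ) : ℝ) * κ) * Real.exp (-(κ * l1 (quo N u - y)))) := by
          refine mul_le_mul_of_nonneg_left ?_ hB
          rw [← Real.exp_add]
          exact Real.exp_le_exp.mpr (by nlinarith)
      _ = B * Real.exp (((d + 1 : ℕ) : ℝ) * κ) * Real.exp (-(κ * l1 (quo N u - y))) := by ring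
  have hcard : ((box1 (d + 1)).card : ℝ) = (3 : ℝ) ^ (d + 1) := by
    simp [box1, Fintype.card_piFinset]
  calc |∑ v ∈ box1 (d + 1), ∑ α : Fin (d + 1), A ((N : ℤ) • y) (u + v) (Sum.inr μ) (Sum.inl α) * elCol κ' u α (u + v)|
      ≤ ∑ v ∈ box1 (d + 1), ∑ α : Fin (d + 1), |A ((N : ℤ) • y) (u + v) (Sum.inr μ) (Sum.inl α) * elCol κ' u α (u + v)| :=
        (abs_sum_le_sum_abs _ _).trans (sum_le_sum fun v _ => abs_sum_le_sum_abs _ _)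
    _ ≤ ∑ v ∈ box1 (d + 1), ∑ _α : Fin (d + 1),
          B * Real.exp (((d + 1 : ℕ) : ℝ) * κ) * Real.exp (-(κ * l1 (quo N u - y))) * (16 * ((d + 1 : ℕ) : ℝ)) :=
        sum_le_sum fun v hv => sum_le_sum fun α _ => hterm v hv α
    _ = _ := by
        simp only [sum_const, card_univ, Fintype.card_fin, nsmul_eq_mul, hcard]
        push_cast
        ring

/-- [folklore] **L1 IN THE BLOCK-ℓ¹ CURRENCY**: from an ℓ¹-shaped (N1) `|wH κ l z| ≤ C·𝓊·e^{−κ₀|quo N z|₁}`,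
`|lamCoeffOf (KInv N) N μ y κ′ u| ≤ (3^{d+1}·(d+1)·16(d+1)·(C·𝓊)·e^{(d+1)κ₀})·e^{−κ₀|quo N u − y|₁}`. -/
theorem abs_lamCoeffOf_KInv_le_unit_l1 {N : ℕ} [NeZero N] {C 𝓊 κ₀ : ℝ} (hC : 0 ≤ C) (h𝓊 : 0 ≤ 𝓊) (hκ : 0 ≤ κ₀)
    (hH : ∀ (κ l : Fin (d + 1)) (z : Fin (d + 1) → ℤ), |wH (N := N) κ l z| ≤ C * 𝓊 * Real.exp (-(κ₀ * l1 (quo N z))))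
    (μ : Fin (d + 1)) (y : Fin (d + 1) → ℤ) (κ' : Fin (d + 1)) (u : Fin (d + 1) → ℤ) :
    |lamCoeffOf (KInv (N := N)) N μ y κ' u| ≤
      ((3 : ℝ) ^ (d + 1) * ((d + 1 : ℕ) : ℝ) * (16 * ((d + 1 : ℕ) : ℝ)) * (C * 𝓊) * Real.exp (((d + 1 : ℕ) : ℝ) * κ₀)) *
        Real.exp (-(κ₀ * l1 (quo N u - y))) := by
  refine abs_lamCoeffOf_le_block_l1 (Nat.one_le_iff_ne_zero.2 (NeZero.ne N)) (mul_nonneg hC h𝓊) hκ (fun y x μ α => ?_) μ y κ' u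
  rw [KInv_inr_inl_coarse, GamΦ_eq_neg_wH, abs_neg]
  have hq : quo N (x - (N : ℤ) • y) = quo N x - y := by
    rw [sub_eq_add_neg x, ← smul_neg, quo_add_zsmul, sub_eq_add_neg]
  have h := hH α μ (x - (N : ℤ) • y)
  rwa [hq] at h

/-- [folklore] CURRENCY BRIDGE: an ℓ¹-shaped block bound implies the sup-shaped one with the same rate (`‖·‖∞ ≤ |·|₁`), so the sup-currency
lemmas above also apply to ℓ¹-shaped inputs (the converse costs a factor `d+1` in the rate and is not stated). -/
theorem exp_neg_l1_le_exp_neg_supNorm {κ : ℝ} (hκ : 0 ≤ κ) (x : Fin (d + 1) → ℤ) :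
    Real.exp (-(κ * l1 x)) ≤ Real.exp (-(κ * supNorm x)) := by
  have h : supNorm x ≤ l1 x := by
    obtain ⟨i, hi⟩ := exists_supNorm_eq x
    rw [hi]
    unfold l1
    have : ((|x i| : ℤ) : ℝ) = |(x i : ℝ)| := by push_cast; rfl
    rw [this]
    exact Finset.single_le_sum (f := fun μ => |(x μ : ℝ)|) (fun μ _ => abs_nonneg _) (Finset.mem_univ i)
  exact Real.exp_le_exp.mpr (by nlinarith)

end Summit.QuantumFields.BalabanUV.Beta.GAN24.TaylorLamLeg

end
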